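import Summits.BirchSwinnertonDyer.Rank1Residual.GaloisImage.ContinuousH1CoefficientTransport
import Summits.BirchSwinnertonDyer.Rank1Residual.GaloisImage.KolyvaginDerivativeLocalImageTate
import Summits.BirchSwinnertonDyer.Rank1Residual.GaloisImage.PropagatedStructure
import HarnessLib

/-!
# The local companion of GZ-1/GZ-2: a `ℤ_p`-side local image `res_w^* κ = red_* z′` read as
# membership of `loc_w κ̄` in the PROPAGATED local condition `im(H¹(ℚ_w, T_p E) → H¹(ℚ_w, E[p^{k+1}]))`
# (cell `b2b-bsdres`, team n1011, row T-DER-GZ, file GZ-4; seat p13)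

HONEST FRAMING (cell `b2b-bsdres`, run/shared/lean/b2b/bsd-rank1-residual/, verbatim in every
file): the goal of the cell is to DELETE the COMBINATION-SHAPED residual classes of the
Birch–Swinnerton-Dyer formula for ALL analytic-rank `≤ 1` elliptic curves over `ℚ` — "full BSD
formula for every rank `≤ 1` curve in class `C`" assembled STRICTLY from published theorems — so
that the rank-`≤ 1` remainder becomes exactly the CONSTRUCTION-SHAPED classes, which are TYPED
(missing-input `Prop`s), NOT attempted. This is not "finishing BSD". Team n1011 (N10/N11, the
additive block `X4 ∧ p = 3`): research route on the CONSTRUCTION-SHAPED class X4 / §I N11 (route-1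
PORT); TOOL theorems only (no definition, no named fact, no `sorry`); NO Euler system is asserted to
exist (it is the hypothesis `hc`); nothing is booked; no mark / label / flag text moves; census −0.

## What

Row T-DER (n1011-p11) produces Kolyvagin's derivative class `κ_r ∈ H¹_cont(Γ_ℚ, T′)` for a
`ℤ_p`-linear coefficient representation `T′` (THEOREM A3, F5), and row T-DER-BN (n1011-p15, file 5
`Derivative.Rat.exists_sigma_kappa_localImage_tate`) adds, at every finite place `w ∉ r` of
prime-to-`p` degree in `ℚ(μ_r)`, a class `z′ ∈ H¹(ℚ_w, T_p E)` with `red_* z′ = res_w^* κ_r` — the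
local condition `𝓕_can,w = 𝓛_w` of [MR04] Thm. 3.2.4 at the bad places, on the `ℤ_p`-side.  The
Kolyvagin-system files of the tree speak the `ℤ`-linear `DiscreteGaloisModule` currency: the class is
`κ̄_r ∈ galoisCohomology (W.torsionGaloisModule (p^k·p)) 1` (GZ-2,
`TorsionCoeff.Rat.exists_sigma_existsUnique_res_eq_deriv_torsionGaloisModule`) and the local
condition is Mazur–Rubin's canonical structure PROPAGATED from `T_p E`,
`propagatedSelmerStructure W p k (Sum.inr w) = im(H¹(ℚ_w, T_p E) → H¹(ℚ_w, E[p^{k+1}]))`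
(`PropagatedStructure.lean`; Rubin, PCMS 2011 §3.1).  This file is the bridge:

* §1 `CoeffTransport.localization_transport_mem_propagatedRelaxed` — generic (any number field `K`,
  any coefficient ring `R`, any Bloch–Kato datum `D = (V —π→ W)`): for topological representations
  `V′ —red→ X` of `Γ_K` over `R`, additive continuous equivariant `eV : V′ → V`, `e : X → W` with
  `π ∘ eV = e ∘ red`, and a transport `Φ : H¹_cont(Γ_K, X) →+ H¹(K, W)` computed on cocycles by `e`
  (GZ-1), the `R`-side local equation `red_* z′ = res_v^* κ` (file 5's clause (iii) VERBATIM in shape)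
  implies `loc_v (Φ κ) ∈ D.propagatedRelaxed (Sum.inr v)`.  Proof on cocycles: the `R`-side
  coboundary witness pushed through `e` (no duality, no finiteness, no unramifiedness).
* §2 the `E/ℚ` reading: `TorsionCoeff.localization_mem_propagatedSelmerStructure_of_map_red_eq`
  (`V′ = T_p E`, `D = tateTorsionDatum W p k`, `eV = id`) for ANY `ℤ_p`-linear coefficient
  representation `T′` with `red : T_p E ⟶ T′` and an additive continuous equivariant
  `e : T′ → E[p^k·p]` through which `π_{k+1}` factors (`π_{k+1} = e ∘ red`) — e.g. GZ-2's
  `T′ = E[p^{k+1}]_{ℤ_p}` (`torsionRepPadicInt`, `red = tateModuleRed`, `e` the identity of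
  `E[p^{k+1}]` onto `E[p^k·p]` along `geomTorsion_pow_succ_eq`); no instance on `E[p^{k+1}]` is needed
  to state or use it.
* §3 END `TorsionCoeff.Rat.exists_sigma_kappa_localImage_torsionGaloisModule` = n1011-p15's file 5
  `Derivative.Rat.exists_sigma_kappa_localImage_tate` READ IN `ℤ`-CURRENCY along a homeomorphic
  additive equivariant bijection `e : T′ → E[p^k·p]` with `π_{k+1} = e ∘ red`: generators `σ_ℓ`, the
  transport `Φ_U`, a commutation proof and the unique
  `κ̄_r ∈ galoisCohomology (W.torsionGaloisModule (p^k·p)) 1` with `res_{U_r} κ̄_r = D_r (Φ_U (red_*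
  c_{0,r}))` (for `T′ = E[p^{k+1}]_{ℤ_p}` this is GZ-2's END) **together with
  `loc_w κ̄_r ∈ propagatedSelmerStructure W p k (Sum.inr w)` at every finite `w ∉ r` with
  `¬ p ∣ ord(ℓ_w mod ∏_{ℓ∈r} ℓ)`**.

Not here: the good places `v ∤ rpN` (F8/F9: `H¹_ur`), the place `p` (F11/F12), the places of `r`
(THEOREM C).  References: B. Mazur, K. Rubin, *Kolyvagin systems*, Mem. AMS 799 (2004), Def. 3.2.1,
Thm. 3.2.4 [MazurRubin2004]; K. Rubin, *Euler systems and Kolyvagin systems*, PCMS 18 (2011), §3.1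
[Rubin2011]; K. Rubin, *Euler Systems* (2000), Thm. 4.5.1 [Rubin2000]; J.-P. Serre, *Galois
Cohomology* (1997), I.§5, II.§6.1.
-/

noncomputable section

open CategoryTheory Function Finset Field IsDedekindDomain NumberField
open scoped NumberField
open Literature.NumberTheory.GaloisRepresentations Literature.NumberTheory.EllipticCurves

universe u v

/-! ## §1 Generic: a coefficient transport carries an `R`-side local image into the propagated
local condition of a Bloch–Kato datum -/

namespace Summit.BirchSwinnertonDyer.Rank1Residual.GaloisImage.CoeffTransport

variable {K : Type u} [Field K] [NumberField K]
variable {R : Type v} [Ring R] [TopologicalSpace R]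
variable {V M : Type u} [AddCommGroup V] [TopologicalSpace V] [IsTopologicalAddGroup V]
  [AddCommGroup M] [TopologicalSpace M] [DiscreteTopology M]
variable (V' X : TopRep.{u} R (absoluteGaloisGroup K)) (D : BlochKatoDatum K V M)

/-- **A coefficient transport carries an `R`-side local image into the propagated local condition.**
Let `D = (V —π→ M)` be a Bloch–Kato datum over a number field `K` (`ℤ`-linear, `M` discrete),
`red : V′ ⟶ X` a morphism of topological representations of `Γ_K` over a coefficient ring `R`,
`eV : V′ → V` and `e : X → M` additive, continuous and equivariant with `π (eV a) = e (red a)`, and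
`Φ : H¹_cont(Γ_K, X) →+ H¹(K, M)` an additive map computed on cocycles by `e`
(`CoeffTransport.exists_addMonoidHom_oneCocycleClass`).  If at a finite place `v` the pull-back
`res_v^* κ ∈ H¹(Γ_{K_v}, X)` of `κ ∈ H¹_cont(Γ_K, X)` is `red_*` of a class `z′ ∈ H¹(Γ_{K_v}, V′)`
(the shape of `Derivative.Rat.exists_sigma_kappa_localImage_tate` (iii)), then
`loc_v (Φ κ) ∈ D.propagatedRelaxed (Sum.inr v) = im(H¹(K_v, V) → H¹(K_v, M))`.
Proof on cocycles: with `κ = [φ]`, `z′ = [η]` the hypothesis is a `b ∈ X` with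
`red (η g) − φ (res g) = (res g)·b − b`; then `π ∘ eV ∘ η` and `e ∘ φ ∘ res` differ by the
coboundary of `e b`.  Serre, *Galois Cohomology*, I.§5.1, II.§6.1.
[cite: Rubin2011, §3.1 (p. 29)] [cite: MazurRubin2004, Def. 3.2.1] -/
theorem localization_transport_mem_propagatedRelaxed (red : V' ⟶ X)
    (eV : V' →+ V) (heVc : Continuous eV)
    (heV : ∀ (g : absoluteGaloisGroup K) (a : V'), eV (V'.ρ g a) = D.repV g (eV a))
    (e : X →+ M) (hec : Continuous e)
    (he : ∀ (g : absoluteGaloisGroup K) (x : X), e (X.ρ g x) = D.repW g (e x))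
    (hcomp : ∀ a : V', D.proj (eV a) = e (red.hom a))
    (Φ : continuousCohomology 1 X →+ galoisCohomology D.repW 1)
    (hΦ : ∀ (φ : contOneCocycles X) (ψ : contOneCocycles D.repW.toTopRep),
      (∀ g, ψ.1 g = e (φ.1 g)) → Φ (oneCocycleClass X φ) = oneCocycleClass _ ψ)
    (v : HeightOneSpectrum (𝓞 K)) (κ : continuousCohomology 1 X)
    (z' : continuousCohomology 1
      (TopRep.res (absGaloisRestrict K (v.adicCompletion K)).toMonoidHom V'))
    (hz' : ContinuousCohomology.map (ContinuousMonoidHom.id (absoluteGaloisGroup (v.adicCompletion K)))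
        (X := TopRep.res (absGaloisRestrict K (v.adicCompletion K)).toMonoidHom V')
        (Y := TopRep.res (absGaloisRestrict K (v.adicCompletion K)).toMonoidHom X)
        ((TopRep.resFunctor (absGaloisRestrict K (v.adicCompletion K)).toMonoidHom).map red) 1 z' =
      ContinuousCohomology.map (absGaloisRestrict K (v.adicCompletion K))
        (𝟙 (TopRep.res (absGaloisRestrict K (v.adicCompletion K)).toMonoidHom X)) 1 κ) :
    galoisCohomology.localization D.repW (Sum.inr v) 1 (Φ κ) ∈ D.propagatedRelaxed (Sum.inr v) := by
  obtain ⟨φ, rfl⟩ := oneCocycleClass_surjective X κ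
  obtain ⟨η, rfl⟩ := oneCocycleClass_surjective _ z'
  -- the `R`-side coboundary witness `b`: `red (η g) - φ (res g) = (res g)·b - b`
  rw [map_oneCocycleClass, map_oneCocycleClass, ← sub_eq_zero, ← oneCocycleClass_sub,
    oneCocycleClass_eq_zero_iff] at hz'
  obtain ⟨b, hb⟩ := hz'
  -- `Φ [φ] = [e ∘ φ]`
  let ψ : contOneCocycles D.repW.toTopRep :=
    ⟨_, comp_mem_contOneCocycles X D.repW.toTopRep e hec he φ⟩
  have hψ : ∀ g, ψ.1 g = e (φ.1 g) := fun _ => rfl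
  rw [hΦ φ ψ hψ]
  -- the candidate preimage on the `ℤ`-side: `eV ∘ η`, a cocycle of `V|_{Γ_{K_v}}`
  let ηV : contOneCocycles (D.restrictField (v.adicCompletion K)).repV.toTopRep :=
    ⟨_, comp_mem_contOneCocycles (TopRep.res (absGaloisRestrict K (v.adicCompletion K)).toMonoidHom V')
      (D.restrictField (v.adicCompletion K)).repV.toTopRep eV heVc
      (fun g a => heV (absGaloisRestrict K (v.adicCompletion K) g) a) η⟩
  rw [BlochKatoDatum.mem_propagatedRelaxed_iff]
  refine ⟨oneCocycleClass _ ηV, ?_⟩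
  -- both sides on cocycles (`map_oneCocycleClass`)
  have hP : (D.restrictField (v.adicCompletion K)).projMap 1 (oneCocycleClass _ ηV) =
      oneCocycleClass (DiscreteGaloisModule.toTopRep
          (GaloisRep.restrictField (v.adicCompletion K) D.repW))
        (contOneCocycles.pullback (ContinuousMonoidHom.id (absoluteGaloisGroup (v.adicCompletion K)))
          (X := (D.restrictField (v.adicCompletion K)).repV.toTopRep)
          (Y := DiscreteGaloisModule.toTopRep (GaloisRep.restrictField (v.adicCompletion K) D.repW))
          (TopRep.ofHom ⟨⟨D.proj.toIntLinearMap, D.continuous_proj⟩,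
            fun g => ContinuousLinearMap.ext fun x =>
              D.proj_apply (absGaloisRestrict K (v.adicCompletion K) g) x⟩) ηV) :=
    map_oneCocycleClass _ _ _ ηV
  have hΛ : galoisCohomology.localization D.repW (Sum.inr v) 1 (oneCocycleClass _ ψ) =
      oneCocycleClass (DiscreteGaloisModule.toTopRep
          (GaloisRep.restrictField (v.adicCompletion K) D.repW))
        (contOneCocycles.pullback (absGaloisRestrict K (v.adicCompletion K)) (X := D.repW.toTopRep)
          (Y := DiscreteGaloisModule.toTopRep (GaloisRep.restrictField (v.adicCompletion K) D.repW))
          (TopRep.ofHom ⟨ContinuousLinearMap.id ℤ M, fun _ => rfl⟩) ψ) :=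
    map_oneCocycleClass _ _ _ ψ
  change (D.restrictField (v.adicCompletion K)).projMap 1 (oneCocycleClass _ ηV) = _
  rw [hP, hΛ]
  refine sub_eq_zero.mp ((oneCocycleClass_sub _ _ _).symm.trans
    ((oneCocycleClass_eq_zero_iff _ _).2 ⟨e b, fun g => ?_⟩))
  have hbg : red.hom (η.1 g) - φ.1 (absGaloisRestrict K (v.adicCompletion K) g) =
      X.ρ (absGaloisRestrict K (v.adicCompletion K) g) b - b := hb g
  change D.proj (eV (η.1 g)) - e (φ.1 (absGaloisRestrict K (v.adicCompletion K) g)) =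
    D.repW (absGaloisRestrict K (v.adicCompletion K) g) (e b) - e b
  rw [hcomp, ← he, ← map_sub e, ← map_sub e, hbg]

end Summit.BirchSwinnertonDyer.Rank1Residual.GaloisImage.CoeffTransport

/-! ## §2 The `E/ℚ` reading: `V′ = T_p E`, any `ℤ_p`-linear coefficient representation `T′`
through which `π_{k+1} : T_p E → E[p^{k+1}]` factors, the propagated structure `𝓕_can` on `E[p^k · p]` -/

namespace Summit.BirchSwinnertonDyer.Rank1Residual.GaloisImage.TorsionCoeff

open Summit.BirchSwinnertonDyer.Rank1Residual.GaloisImage.CoeffTransport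

section Instance

variable (W : WeierstrassCurve ℚ) (p : ℕ) [Fact p.Prime] (k : ℕ)

omit [Fact p.Prime] in
/-- `E[p^{k+1}] = E[p^k · p]` as subgroups of `E(ℚ̄)` (the two spellings of the level: GZ-2's
`(p ^ n : ℕ)` with `n = k + 1` and `PropagatedStructure`'s `(p : ℤ) ^ k * p`). [folklore] -/
theorem geomTorsion_pow_succ_eq :
    WeierstrassCurve.geomTorsion W ((p ^ (k + 1) : ℕ) : ℤ) =
      WeierstrassCurve.geomTorsion W ((p : ℤ) ^ k * (p : ℤ)) := by
  rw [Nat.cast_pow, pow_succ]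

variable [W.IsElliptic]

/-- **The `E/ℚ` reading of §1.**  Let `T′` be a `ℤ_p`-linear continuous representation of `Γ_ℚ` on
`M′` with a morphism `red : T_p E ⟶ T′` and an additive continuous equivariant `e : M′ → E[p^k·p]`
through which the reduction factors, `π_{k+1} = e ∘ red` (e.g. `T′ = E[p^{k+1}]_{ℤ_p}`,
`red = red_{k+1}`, `e` the identity — GZ-2's `torsionRepPadicInt` / `tateModuleRed`; or
`T′ = T_p E / p^{k+1}`), and `Φ : H¹_cont(Γ_ℚ, T′) →+ galoisCohomology (W.torsionGaloisModule
(p^k·p)) 1` computed on cocycles by `e` (GZ-1).  If at a finite place `w` the pull-back `res_w^* κ`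
is `red_* z′` for some `z′ ∈ H¹(ℚ_w, T_p E)` (clause (iii) of
`Derivative.Rat.exists_sigma_kappa_localImage_tate`, VERBATIM in shape), then
`loc_w (Φ κ) ∈ propagatedSelmerStructure W p k (Sum.inr w)` — Mazur–Rubin's `𝓕_can,w` on
`E[p^{k+1}]`. [cite: Rubin2011, §3.1 (p. 29)] [cite: MazurRubin2004, Def. 3.2.1] -/
theorem localization_mem_propagatedSelmerStructure_of_map_red_eq
    [ContinuousSMul ℤ_[p] (W.tateModule p)]
    {M' : Type} [AddCommGroup M'] [Module ℤ_[p] M'] [TopologicalSpace M'] [IsTopologicalAddGroup M']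
    [ContinuousSMul ℤ_[p] M'] {T' : GaloisRep ℚ ℤ_[p] M'}
    (red : (W.tateGaloisRep p (W.continuous_galoisRepTate_holds p)).toTopRep ⟶ T'.toTopRep)
    (e : M' →+ WeierstrassCurve.geomTorsion W ((p : ℤ) ^ k * (p : ℤ))) (hec : Continuous e)
    (he : ∀ (g : absoluteGaloisGroup ℚ) (x : M'),
      e (T' g x) = W.torsionGaloisModule ((p : ℤ) ^ k * (p : ℤ)) g (e x))
    (hcomp : ∀ a : W.tateModule p, tateToTorsion W p k a = e (red.hom a))
    (Φ : continuousCohomology 1 T'.toTopRep →+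
      galoisCohomology (W.torsionGaloisModule ((p : ℤ) ^ k * (p : ℤ))) 1)
    (hΦ : ∀ (φ : contOneCocycles T'.toTopRep)
      (ψ : contOneCocycles (W.torsionGaloisModule ((p : ℤ) ^ k * (p : ℤ))).toTopRep),
      (∀ g, ψ.1 g = e (φ.1 g)) → Φ (oneCocycleClass _ φ) = oneCocycleClass _ ψ)
    (w : HeightOneSpectrum (𝓞 ℚ)) (κ : continuousCohomology 1 T'.toTopRep)
    (z' : continuousCohomology 1 (TopRep.res (absGaloisRestrict ℚ (w.adicCompletion ℚ)).toMonoidHom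
      (W.tateGaloisRep p (W.continuous_galoisRepTate_holds p)).toTopRep))
    (hz' : ContinuousCohomology.map (ContinuousMonoidHom.id (absoluteGaloisGroup (w.adicCompletion ℚ)))
        (X := TopRep.res (absGaloisRestrict ℚ (w.adicCompletion ℚ)).toMonoidHom
          (W.tateGaloisRep p (W.continuous_galoisRepTate_holds p)).toTopRep)
        (Y := TopRep.res (absGaloisRestrict ℚ (w.adicCompletion ℚ)).toMonoidHom T'.toTopRep)
        ((TopRep.resFunctor (absGaloisRestrict ℚ (w.adicCompletion ℚ)).toMonoidHom).map red) 1 z' =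
      ContinuousCohomology.map (absGaloisRestrict ℚ (w.adicCompletion ℚ))
        (𝟙 (TopRep.res (absGaloisRestrict ℚ (w.adicCompletion ℚ)).toMonoidHom T'.toTopRep)) 1 κ) :
    galoisCohomology.localization (W.torsionGaloisModule ((p : ℤ) ^ k * (p : ℤ))) (Sum.inr w) 1 (Φ κ) ∈
      propagatedSelmerStructure W p k (Sum.inr w) :=
  localization_transport_mem_propagatedRelaxed
    (W.tateGaloisRep p (W.continuous_galoisRepTate_holds p)).toTopRep T'.toTopRep
    (tateTorsionDatum W p k) red (AddMonoidHom.id _) continuous_id (fun _ _ => rfl)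
    e hec (fun g x => he g x) (fun a => hcomp a) Φ hΦ w κ z' hz'

end Instance

/-! ## §3 END: Kolyvagin's derivative class of `T_p E` with its local image at the places of
prime-to-`p` degree, read in `galoisCohomology (W.torsionGaloisModule (p^k·p)) 1` -/

section Reading

open _root_.Rat.HeightOneSpectrum

variable (W : WeierstrassCurve ℚ) [W.IsElliptic] [W.IsGloballyMinimal] (p : ℕ) [Fact p.Prime] (k : ℕ)

/-- **Kolyvagin's derivative class of `T_p E` READ IN `ℤ`-CURRENCY, with the propagated local
condition at the places of prime-to-`p` degree.**  Hypotheses = n1011-p15's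
`Derivative.Rat.exists_sigma_kappa_localImage_tate` VERBATIM (an Euler system `c` of `T_p E` over
`cyclotomicLevelsRat p S` — a HYPOTHESIS —, a `ℤ_p`-linear coefficient map `red : T_p E ⟶ T′` with
`p^{k+1} T′ = 0`, a level `r` of Kolyvagin primes of level `k + 1`) plus a homeomorphic additive
equivariant bijection `e : T′ → E[p^k·p]` (inverse `einv`) with `π_{k+1} = e ∘ red`, and
`E[p^k·p]^{Gal(ℚ̄/ℚ(μ_r))} = 0`.  Then there are generators `σ_ℓ` (T-DER-INST), an additive
transport `Φ_U : H¹(U_r, T′) →+ H¹(U_r, E[p^k·p]_ℤ)` computed on cocycles by `e` (GZ-1), a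
commutation proof and a class `κ̄ ∈ galoisCohomology (W.torsionGaloisModule (p^k·p)) 1` with
(i) `res_{U_r} κ̄ = D_r (Φ_U (red_* c_{0,r}))`, (ii) `κ̄` unique with (i), and
(iii) **for every finite `w ∉ r` with `¬ p ∣ ord(ℓ_w mod ∏_{ℓ∈r} ℓ)`:
`loc_w κ̄ ∈ propagatedSelmerStructure W p k (Sum.inr w)`** (`= 𝓕_can,w`, the local condition of
[MR04] Thm. 3.2.4 at the bad places `w ∣ N`, `w ∤ rp`; `w = p` allowed).  For `T′ = E[p^{k+1}]_{ℤ_p}`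
(GZ-2: `torsionRepPadicInt`, `red = tateModuleRed`, `hM = pow_smul_eq_zero`, `e`/`einv` the
inclusions along `geomTorsion_pow_succ_eq`) clauses (i)–(ii) are GZ-2's END
`Rat.exists_sigma_existsUnique_res_eq_deriv_torsionGaloisModule`; the proof is that proof with F5
replaced by p15's file 5 and §2 for (iii).  The instance arguments on `T_p E` are the tree's
`W.module_free_tateModule_holds p`, `W.module_finite_tateModule_holds p`,
`TateModule.continuousSMul_padicInt` (supply with `haveI`).
[cite: Rubin2000, Def. 4.4.4 and Thm. 4.5.1] [cite: MazurRubin2004, Thm. 3.2.4 and App. A]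
[cite: Rubin2011, §3.1 (p. 29)] -/
theorem Rat.exists_sigma_kappa_localImage_torsionGaloisModule
    [Module.Free ℤ_[p] (W.tateModule p)] [Module.Finite ℤ_[p] (W.tateModule p)]
    [ContinuousSMul ℤ_[p] (W.tateModule p)]
    (S : Set (HeightOneSpectrum (𝓞 ℚ)))
    {c : ∀ (i : ℕ) (r : (cyclotomicLevelsRat p S).Ideals),
      H1 (W.tateGaloisRep p (W.continuous_galoisRepTate_holds p)) ((cyclotomicLevelsRat p S).level i r.1)}
    (hc : IsEulerSystem (cyclotomicLevelsRat p S)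
      (W.tateGaloisRep p (W.continuous_galoisRepTate_holds p)) p c)
    {M' : Type} [AddCommGroup M'] [Module ℤ_[p] M'] [TopologicalSpace M'] [IsTopologicalAddGroup M']
    [ContinuousSMul ℤ_[p] M'] {T' : GaloisRep ℚ ℤ_[p] M'}
    (red : (W.tateGaloisRep p (W.continuous_galoisRepTate_holds p)).toTopRep ⟶ T'.toTopRep)
    (hM : ∀ m : M', ((p : ℤ_[p]) ^ (k + 1)) • m = 0)
    (e : M' →+ WeierstrassCurve.geomTorsion W ((p : ℤ) ^ k * (p : ℤ)))
    (einv : WeierstrassCurve.geomTorsion W ((p : ℤ) ^ k * (p : ℤ)) →+ M')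
    (hec : Continuous e) (hic : Continuous einv)
    (he : ∀ (g : absoluteGaloisGroup ℚ) (x : M'),
      e (T' g x) = W.torsionGaloisModule ((p : ℤ) ^ k * (p : ℤ)) g (e x))
    (h₁ : ∀ x, einv (e x) = x) (h₂ : ∀ y, e (einv y) = y)
    (hcomp : ∀ a : W.tateModule p, tateToTorsion W p k a = e (red.hom a))
    (r : (cyclotomicLevelsRat p S).Ideals)
    (hr : ∀ ℓ ∈ r.1, Kato.IsKolyvaginPrime W p (k + 1) ((primesEquiv ℓ : Nat.Primes) : ℕ))
    (h0 : ∀ P : WeierstrassCurve.geomTorsion W ((p : ℤ) ^ k * (p : ℤ)),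
      (∀ u : (cyclotomicLevelsRat p S).level ⊥ r.1, (u : absoluteGaloisGroup ℚ) • P = P) → P = 0) :
    ∃ σ : HeightOneSpectrum (𝓞 ℚ) → absoluteGaloisGroup ℚ,
      (∀ ℓ ∈ r.1, ∀ m : ℕ, (((primesEquiv ℓ : Nat.Primes) : ℕ)).Coprime m → σ ℓ ∈ rootsOfUnityFixer ℚ m) ∧
      (∀ ℓ ∈ r.1, ∀ g : absoluteGaloisGroup ℚ,
        ∃ j < ((primesEquiv ℓ : Nat.Primes) : ℕ) - 1,
          (σ ℓ ^ j)⁻¹ * g ∈ (cyclotomicLevelsRat p S).tameLevel ℓ) ∧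
      ∃ (Φ : continuousCohomology 1 (subgroupRep T'.toTopRep ((cyclotomicLevelsRat p S).level ⊥ r.1)) →+
            continuousCohomology 1 (subgroupRep (W.torsionGaloisModule ((p : ℤ) ^ k * (p : ℤ))).toTopRep
              ((cyclotomicLevelsRat p S).level ⊥ r.1))),
        (∀ (φ : contOneCocycles (subgroupRep T'.toTopRep ((cyclotomicLevelsRat p S).level ⊥ r.1)))
           (ψ : contOneCocycles (subgroupRep (W.torsionGaloisModule ((p : ℤ) ^ k * (p : ℤ))).toTopRep
              ((cyclotomicLevelsRat p S).level ⊥ r.1))),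
          (∀ g, ψ.1 g = e (φ.1 g)) → Φ (oneCocycleClass _ φ) = oneCocycleClass _ ψ) ∧
      ∃ comm, ∃ κ : galoisCohomology (W.torsionGaloisModule ((p : ℤ) ^ k * (p : ℤ))) 1,
        resSubgroup (W.torsionGaloisModule ((p : ℤ) ^ k * (p : ℤ))).toTopRep
            ((cyclotomicLevelsRat p S).level ⊥ r.1) 1 κ =
          (r.1.noncommProd (fun ℓ => ∑ j ∈ range (((primesEquiv ℓ : Nat.Primes) : ℕ) - 1),
              (j : Module.End ℤ (continuousCohomology 1
              (subgroupRep (W.torsionGaloisModule ((p : ℤ) ^ k * (p : ℤ))).toTopRep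
                ((cyclotomicLevelsRat p S).level ⊥ r.1)))) *
            (conjMap (W.torsionGaloisModule ((p : ℤ) ^ k * (p : ℤ))).toTopRep
              ((cyclotomicLevelsRat p S).level ⊥ r.1) (σ ℓ) 1).hom.toLinearMap ^ j) comm)
          (Φ (ContinuousCohomology.map (ContinuousMonoidHom.id _)
            (X := subgroupRep (W.tateGaloisRep p (W.continuous_galoisRepTate_holds p)).toTopRep
              ((cyclotomicLevelsRat p S).level ⊥ r.1))
            (Y := subgroupRep T'.toTopRep ((cyclotomicLevelsRat p S).level ⊥ r.1))
            ((TopRep.resFunctor ((cyclotomicLevelsRat p S).level ⊥ r.1).subtype).map red) 1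
            (c ⊥ r))) ∧
        (∀ κ' : galoisCohomology (W.torsionGaloisModule ((p : ℤ) ^ k * (p : ℤ))) 1,
          resSubgroup (W.torsionGaloisModule ((p : ℤ) ^ k * (p : ℤ))).toTopRep
              ((cyclotomicLevelsRat p S).level ⊥ r.1) 1 κ' =
            (r.1.noncommProd (fun ℓ => ∑ j ∈ range (((primesEquiv ℓ : Nat.Primes) : ℕ) - 1),
                (j : Module.End ℤ (continuousCohomology 1
                (subgroupRep (W.torsionGaloisModule ((p : ℤ) ^ k * (p : ℤ))).toTopRep
                  ((cyclotomicLevelsRat p S).level ⊥ r.1)))) *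
              (conjMap (W.torsionGaloisModule ((p : ℤ) ^ k * (p : ℤ))).toTopRep
                ((cyclotomicLevelsRat p S).level ⊥ r.1) (σ ℓ) 1).hom.toLinearMap ^ j) comm)
            (Φ (ContinuousCohomology.map (ContinuousMonoidHom.id _)
              (X := subgroupRep (W.tateGaloisRep p (W.continuous_galoisRepTate_holds p)).toTopRep
                ((cyclotomicLevelsRat p S).level ⊥ r.1))
              (Y := subgroupRep T'.toTopRep ((cyclotomicLevelsRat p S).level ⊥ r.1))
              ((TopRep.resFunctor ((cyclotomicLevelsRat p S).level ⊥ r.1).subtype).map red) 1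
              (c ⊥ r))) → κ' = κ) ∧
        ∀ w : HeightOneSpectrum (𝓞 ℚ), (∀ q ∈ r.1, q ≠ w) →
          ¬ p ∣ orderOf ((((primesEquiv w : Nat.Primes) : ℕ) :
            ZMod (∏ q ∈ r.1, ((primesEquiv q : Nat.Primes) : ℕ)))) →
          galoisCohomology.localization (W.torsionGaloisModule ((p : ℤ) ^ k * (p : ℤ))) (Sum.inr w) 1 κ ∈
            propagatedSelmerStructure W p k (Sum.inr w) := by
  -- abbreviations (`T'.toTopRep` is written out: `red`'s type depends on it)
  set U := (cyclotomicLevelsRat p S).level ⊥ r.1 with hU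
  set Y := (W.torsionGaloisModule ((p : ℤ) ^ k * (p : ℤ))).toTopRep with hY
  have he' : ∀ (g : absoluteGaloisGroup ℚ) (x : T'.toTopRep), e (T'.toTopRep.ρ g x) = Y.ρ g (e x) :=
    fun g x => he g x
  -- `h0` in `T′`-currency
  have h0' : ∀ v : T'.toTopRep, (∀ u : U, T'.toTopRep.ρ (u : absoluteGaloisGroup ℚ) v = v) → v = 0 := by
    intro v hv
    have h := h0 (e v) fun u => by
      have h1 := congrArg e (hv u)
      rw [he'] at h1
      exact h1
    have h2 := congrArg einv h
    rwa [h₁, map_zero] at h2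
  -- file 5 (p15) for `T′`
  obtain ⟨σ, hcop, hcov, comm, κ', hκ', huniq, hloc⟩ :=
    Derivative.Rat.exists_sigma_kappa_localImage_tate W p S (show 0 < k + 1 by omega) hc red hM r hr h0'
  -- the transports (GZ-1): on `Γ_ℚ` (an additive isomorphism) and on `U_r`
  obtain ⟨Φ₀, hΦ₀⟩ := exists_addEquiv_oneCocycleClass T'.toTopRep Y e hec he' einv hic h₁ h₂
  obtain ⟨Φ, hΦ⟩ := exists_addMonoidHom_oneCocycleClass (subgroupRep T'.toTopRep U) (subgroupRep Y U)
    e hec (fun g x => he' g x)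
  have hΦinj : Function.Injective Φ :=
    injective_of_oneCocycleClass (subgroupRep T'.toTopRep U) (subgroupRep Y U) e (fun g x => he' g x)
      einv h₁ h₂ Φ hΦ hec
  refine ⟨σ, hcop, hcov, Φ, hΦ, Derivative.pairwise_commute_deriv (L := cyclotomicLevelsRat p S)
    (T' := W.torsionGaloisModule ((p : ℤ) ^ k * (p : ℤ))) ⊥ r.1 σ _, Φ₀ κ', ?_, fun κ₁ hκ₁ => ?_,
    fun w hw hord => ?_⟩
  · -- (i) the restriction of the transported class is the transported derivative
    change resSubgroup Y U 1 (Φ₀.toAddMonoidHom κ') = _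
    rw [← comm_resSubgroup T'.toTopRep Y e U Φ₀.toAddMonoidHom (fun φ ψ h => hΦ₀ φ ψ h) Φ hΦ hec
      he' κ', hκ', comm_noncommProd_deriv_conjMap T'.toTopRep Y e U σ _ r.1 Φ hΦ hec he']
  · -- (ii) uniqueness: pull back along the additive isomorphism and use `T′`-side uniqueness
    have hpre : resSubgroup T'.toTopRep U 1 (Φ₀.symm κ₁) = resSubgroup T'.toTopRep U 1 κ' := by
      apply hΦinj
      rw [hκ', comm_noncommProd_deriv_conjMap T'.toTopRep Y e U σ _ r.1 Φ hΦ hec he',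
        comm_resSubgroup T'.toTopRep Y e U Φ₀.toAddMonoidHom (fun φ ψ h => hΦ₀ φ ψ h) Φ hΦ hec he'
          (Φ₀.symm κ₁)]
      change resSubgroup Y U 1 (Φ₀ (Φ₀.symm κ₁)) = _
      rw [AddEquiv.apply_symm_apply]
      exact hκ₁
    have h3 := huniq (Φ₀.symm κ₁) (hpre.trans hκ')
    rw [← h3, AddEquiv.apply_symm_apply]
  · -- (iii) the local image at `w`, read in `𝓕_can,w` (§2)
    obtain ⟨z', hz'⟩ := hloc w hw hord
    exact localization_mem_propagatedSelmerStructure_of_map_red_eq W p k red e hec he hcomp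
      Φ₀.toAddMonoidHom (fun φ ψ h => hΦ₀ φ ψ h) w κ' z' hz'

end Reading

end Summit.BirchSwinnertonDyer.Rank1Residual.GaloisImage.TorsionCoeff

end
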